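import Summits.CriticalPhenomena.PercolationContinuityZ3.Theorems.PercNearOneGluingNoHeavyQuantTwoBig
import HarnessLib

/-!
# QUANT lane R8, Conjecture DIB\* — TWO FULL-SIZE BIGS: `TwoBigCertAt j j j` holds, hence DIB\* for every system `(j, j, cloud ≤ j/2)`

builds on p205010 (kernel theorem, internal audit signed; external expert review pending)

Support file (`--supports stmt-CriticalPhenomena-4575`), QUANT lane lead (gen 19); memo `prim-quant-lead-g19/LEAD-NOTES-G19.md` N39.  Theorems only;
no sorries, standard axioms.  Companion of `…QuantTwoBig` (the F2 reduction `RootDec.twoBig_row_of_certAt`) and `…QuantOneBigCert` (the chains).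

The sub-cell of F2 in which BOTH bigs have the full size `j` (the shapes `(j, j, s, s′, …)` named as the first F2 targets in HANDOFF GEN-18): the help
levels are `ℓ₁ = ℓ₂ = 0`, the cloud's credit infimum is `C = j(d₁ + d₂)` (`dᵢ = 1 − φᵢ`), and after the chains of `…QuantOneBigCert` (Cantelli at
level 0 for the two 'one big open' branches: `(1−x)/((1−x) + 2(d₁+d₂))`; Cantelli at level `j` for the 'both closed' branch when `d₁ + d₂ ≥ 1`,
the trivial bound otherwise) what is left are FIVE polynomial inequalities in `(y, d₁, d₂)` (heavy/heavy, heavy/light × 2 regions, light/light × 2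
regions), each closed by `linarith` with a Handelman certificate (kit j132967: degrees 3/4/5/5/6, supports 7/17/34/17/37).

* `Quant.IndepBlob.TwoFullBigsIneq.hhR0_poly` … `llR1_poly` — the certificates; `fin_R0`, `fin_R1` — the glue.
* **`Quant.IndepBlob.twoBigCertAt_full : ∀ j, TwoBigCertAt j j j`.**
* **`Quant.RootDec.tail_ge_of_twoFullBigs`** — DIB\* (floor `1/2 ≤ x < 1`, gates `≥ x²`, credit `> 2j`) for every system with two blobs of size
  exactly `j` and all other blobs of size `≤ j/2`.
[this work]; the gluing rows served [cite: KozmaNitzan2024, Conjecture 3 (p. 15)]; product weights [cite: Grimmett1999, §1.3 p. 10].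
-/

namespace Summit.CriticalPhenomena.PercolationContinuityZ3.Theorems
namespace Quant
namespace IndepBlob
namespace TwoFullBigsIneq

/-- (HH, region R0) Handelman certificate for the (j,j)-cell, degree 3, 7 products (kit j132967). [this work] -/
theorem hhR0_poly (y d1 d2 : ℝ) (hy : 0 ≤ y) (_hy2 : 0 ≤ 1 / 2 - y) (hd1 : 0 ≤ d1) (hd1y : 0 ≤ y - d1) (hd2 : 0 ≤ d2) (hd2y : 0 ≤ y - d2) (hreg : 0 ≤ 1 - (d1 + d2)) :
    0 ≤ y * (y + 2 * (d1 + d2)) - d1 * d2 * (y + 2 * (d1 + d2)) - ((1 - d1) * d2 + d1 * (1 - d2)) * y := by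
  linarith [mul_nonneg hd1y hd2, mul_nonneg hd1 hd2y, mul_nonneg (mul_nonneg hd1 hd2) hreg, mul_nonneg (mul_nonneg hd1 hd2) hd2y, mul_nonneg (mul_nonneg hd1 hd1y) hd2, mul_nonneg hy hd2, mul_nonneg hy hy]

/-- (HL, region R0) Handelman certificate for the (j,j)-cell, degree 4, 17 products (kit j132967). [this work] -/
theorem hlR0_poly (y d1 d2 : ℝ) (hy : 0 ≤ y) (hy2 : 0 ≤ 1 / 2 - y) (hd1 : 0 ≤ d1) (hd1y : 0 ≤ y - d1) (hd2 : 0 ≤ d2 - y) (_hd2b : 0 ≤ 1 - d2) (hreg : 0 ≤ 1 - (d1 + d2)) :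
    0 ≤ y * (y + 2 * (d1 + d2)) - d1 * (y * (1 - y + d2)) * (y + 2 * (d1 + d2)) - ((1 - d1) * (y * (1 - y + d2)) + d1 * (1 - (y * (1 - y + d2)))) * y := by
  linarith [mul_nonneg hd1y hd2, mul_nonneg (mul_nonneg (mul_nonneg hd1y hd1y) hd2) hd2, mul_nonneg (mul_nonneg hd1 hd2) hreg, mul_nonneg (mul_nonneg (mul_nonneg hd1 hd1y) hd1y) hd2, mul_nonneg (mul_nonneg (mul_nonneg hd1 hd1) hd2) hreg, mul_nonneg (mul_nonneg (mul_nonneg hy2 hd1) hd2) hd2, mul_nonneg hy hd2, mul_nonneg (mul_nonneg hy hd2) hreg, mul_nonneg (mul_nonneg hy hd2) hd2, mul_nonneg hy hd1y, mul_nonneg (mul_nonneg hy hd1y) hd2, mul_nonneg (mul_nonneg hy hd1) hreg, mul_nonneg (mul_nonneg (mul_nonneg hy hd1) hd2) hreg, mul_nonneg (mul_nonneg hy hd1) hd1y, mul_nonneg (mul_nonneg (mul_nonneg hy hd1) hd1y) hd2, mul_nonneg (mul_nonneg (mul_nonneg hy hy2) hd2) hd2, mul_nonneg hy hy]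

/-- (HL, region R1) Handelman certificate for the (j,j)-cell, degree 5, 34 products (kit j132967). [this work] -/
theorem hlR1_poly (y d1 d2 : ℝ) (hy : 0 ≤ y) (hy2 : 0 ≤ 1 / 2 - y) (hd1 : 0 ≤ d1) (hd1y : 0 ≤ y - d1) (hd2 : 0 ≤ d2 - y) (hd2b : 0 ≤ 1 - d2) (hreg : 0 ≤ (d1 + d2) - 1) :
    0 ≤ (y * (d1 + d2) + 2 * ((d1 + d2) - 1) ^ 2) * (y + 2 * (d1 + d2)) - d1 * (y * (1 - y + d2)) * (d1 + d2) * (y + 2 * (d1 + d2)) - ((1 - d1) * (y * (1 - y + d2)) + d1 * (1 - (y * (1 - y + d2)))) * (y * (d1 + d2) + 2 * ((d1 + d2) - 1) ^ 2) := by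
  linarith [mul_nonneg hreg hreg, mul_nonneg (mul_nonneg hreg hreg) hreg, mul_nonneg (mul_nonneg (mul_nonneg hd2b hreg) hreg) hreg, mul_nonneg hd2b hd2b, mul_nonneg (mul_nonneg (mul_nonneg hd2b hd2b) hd2b) hreg, mul_nonneg (mul_nonneg hd2 hreg) hreg, mul_nonneg (mul_nonneg hd2 hd2) hreg, mul_nonneg (mul_nonneg (mul_nonneg hd2 hd2) hreg) hreg, hd1y, mul_nonneg hd1y hreg, mul_nonneg (mul_nonneg hd1y hd1y) hreg, mul_nonneg (mul_nonneg hd1y hd1y) hd2, mul_nonneg (mul_nonneg (mul_nonneg hd1y hd1y) hd2) hreg, mul_nonneg (mul_nonneg (mul_nonneg hd1y hd1y) hd2) hd2, mul_nonneg (mul_nonneg hd1 hd2) hd2, mul_nonneg (mul_nonneg (mul_nonneg hd1 hd2) hd2) hreg, mul_nonneg (mul_nonneg hd1 hd1y) hd1y, mul_nonneg (mul_nonneg (mul_nonneg hd1 hd1y) hd1y) hd2, mul_nonneg hy2 hd2b, mul_nonneg (mul_nonneg (mul_nonneg (mul_nonneg hy2 hy2) hd1) hd2) hreg, mul_nonneg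 (mul_nonneg (mul_nonneg hy2 hy2) hd1) hd1, hy, mul_nonneg (mul_nonneg hy hd2) hd2, mul_nonneg (mul_nonneg (mul_nonneg hy hd2) hd2) hreg, mul_nonneg (mul_nonneg (mul_nonneg hy hd2) hd2) hd2, mul_nonneg hy hd1y, mul_nonneg (mul_nonneg hy hd1y) hreg, mul_nonneg (mul_nonneg (mul_nonneg hy hd1) hreg) hreg, mul_nonneg (mul_nonneg (mul_nonneg (mul_nonneg hy hd1) hd2) hreg) hreg, mul_nonneg (mul_nonneg hy hy) hreg, mul_nonneg (mul_nonneg (mul_nonneg hy hy) hreg) hreg, mul_nonneg (mul_nonneg (mul_nonneg hy hy) hd1) hreg, mul_nonneg (mul_nonneg (mul_nonneg hy hy) hy) hreg, mul_nonneg (mul_nonneg (mul_nonneg hy hy) hy) hd1]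

/-- (LL, region R0) Handelman certificate for the (j,j)-cell, degree 5, 17 products (kit j132967). [this work] -/
theorem llR0_poly (y d1 d2 : ℝ) (hy : 0 ≤ y) (hy2 : 0 ≤ 1 / 2 - y) (hd1 : 0 ≤ d1 - y) (hd1b : 0 ≤ 1 - d1) (hd2 : 0 ≤ d2 - y) (hd2b : 0 ≤ 1 - d2) (hreg : 0 ≤ 1 - (d1 + d2)) :
    0 ≤ y * (y + 2 * (d1 + d2)) - (y * (1 - y + d1)) * (y * (1 - y + d2)) * (y + 2 * (d1 + d2)) - ((1 - (y * (1 - y + d1))) * (y * (1 - y + d2)) + (y * (1 - y + d1)) * (1 - (y * (1 - y + d2)))) * y := by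
  linarith [mul_nonneg (mul_nonneg hy hd2) hd2b, mul_nonneg (mul_nonneg hy hd1b) hd2, mul_nonneg hy hd1, mul_nonneg (mul_nonneg (mul_nonneg hy hd1) hd2) hreg, mul_nonneg (mul_nonneg hy hd1) hd1b, mul_nonneg (mul_nonneg hy hy2) hd2, mul_nonneg (mul_nonneg (mul_nonneg hy hy2) hd2) hd2, mul_nonneg (mul_nonneg hy hy2) hd1, mul_nonneg (mul_nonneg (mul_nonneg hy hy2) hd1) hd2, mul_nonneg (mul_nonneg (mul_nonneg (mul_nonneg hy hy2) hd1) hd2) hd2, mul_nonneg (mul_nonneg (mul_nonneg hy hy2) hd1) hd1, mul_nonneg (mul_nonneg (mul_nonneg (mul_nonneg hy hy2) hd1) hd1) hd2, mul_nonneg (mul_nonneg hy hy) hd2b, mul_nonneg (mul_nonneg (mul_nonneg hy hy) hd2) hreg, mul_nonneg (mul_nonneg hy hy) hd1b, mul_nonneg (mul_nonneg (mul_nonneg hy hy) hd1) hreg, mul_nonneg (mul_nonneg (mul_nonneg (mul_nonneg hy hy) hd1) hd2) hreg]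

/-- (LL, region R1) Handelman certificate for the (j,j)-cell, degree 6, 37 products (kit j132967). [this work] -/
theorem llR1_poly (y d1 d2 : ℝ) (hy : 0 ≤ y) (hy2 : 0 ≤ 1 / 2 - y) (hd1 : 0 ≤ d1 - y) (hd1b : 0 ≤ 1 - d1) (hd2 : 0 ≤ d2 - y) (hd2b : 0 ≤ 1 - d2) (hreg : 0 ≤ (d1 + d2) - 1) :
    0 ≤ (y * (d1 + d2) + 2 * ((d1 + d2) - 1) ^ 2) * (y + 2 * (d1 + d2)) - (y * (1 - y + d1)) * (y * (1 - y + d2)) * (d1 + d2) * (y + 2 * (d1 + d2)) - ((1 - (y * (1 - y + d1))) * (y * (1 - y + d2)) + (y * (1 - y + d1)) * (1 - (y * (1 - y + d2)))) * (y * (d1 + d2) + 2 * ((d1 + d2) - 1) ^ 2) := by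
  linarith [mul_nonneg hreg hreg, mul_nonneg (mul_nonneg hreg hreg) hreg, mul_nonneg (mul_nonneg hd2 hreg) hreg, mul_nonneg (mul_nonneg (mul_nonneg (mul_nonneg hd1b hd2b) hreg) hreg) hreg, mul_nonneg (mul_nonneg (mul_nonneg (mul_nonneg hd1b hd2) hd2) hreg) hreg, mul_nonneg (mul_nonneg hd1 hreg) hreg, mul_nonneg (mul_nonneg (mul_nonneg (mul_nonneg hd1 hd1) hd2b) hreg) hreg, mul_nonneg (mul_nonneg (mul_nonneg hy2 hd2) hreg) hreg, mul_nonneg (mul_nonneg (mul_nonneg hy2 hd1) hreg) hreg, mul_nonneg (mul_nonneg (mul_nonneg hy2 hy2) hreg) hreg, mul_nonneg (mul_nonneg (mul_nonneg (mul_nonneg (mul_nonneg hy2 hy2) hd1) hd2) hreg) hreg, hy, mul_nonneg (mul_nonneg (mul_nonneg (mul_nonneg hy hreg) hreg) hreg) hreg, mul_nonneg (mul_nonneg (mul_nonneg (mul_nonneg hy hd2) hd2b) hd2b) hd2b, mul_nonneg (mul_nonneg hy hd2) hd2, mul_nonneg (mul_nonneg (mul_nonneg (mul_nonneg hy hd2)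 hd2) hd2b) hreg, mul_nonneg (mul_nonneg (mul_nonneg hy hd2) hd2) hd2, mul_nonneg (mul_nonneg (mul_nonneg (mul_nonneg hy hd2) hd2) hd2) hd2, mul_nonneg (mul_nonneg hy hd1) hd2, mul_nonneg (mul_nonneg (mul_nonneg (mul_nonneg hy hd1) hd2) hd2) hreg, mul_nonneg (mul_nonneg (mul_nonneg (mul_nonneg hy hd1) hd2) hd2) hd2, mul_nonneg (mul_nonneg (mul_nonneg (mul_nonneg hy hd1) hd1b) hd1b) hd1b, mul_nonneg (mul_nonneg hy hd1) hd1, mul_nonneg (mul_nonneg (mul_nonneg (mul_nonneg hy hd1) hd1) hd2) hreg, mul_nonneg (mul_nonneg (mul_nonneg (mul_nonneg hy hd1) hd1) hd2) hd2, mul_nonneg (mul_nonneg (mul_nonneg (mul_nonneg hy hd1) hd1) hd1b) hreg, mul_nonneg (mul_nonneg (mul_nonneg hy hd1) hd1) hd1, mul_nonneg (mul_nonneg (mul_nonneg (mul_nonneg hy hd1) hd1) hd1) hd2, mul_nonneg (mul_nonneg (mul_nonneg (mul_nonneg hy hd1) hd1) hd1) hd1, mul_nonneg (mul_nonneg (mul_nonneg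 hy hy2) hd1) hd2, mul_nonneg (mul_nonneg (mul_nonneg (mul_nonneg hy hy2) hd1) hd2) hreg, mul_nonneg (mul_nonneg hy hy2) hy2, mul_nonneg (mul_nonneg (mul_nonneg hy hy2) hy2) hreg, mul_nonneg (mul_nonneg (mul_nonneg (mul_nonneg (mul_nonneg hy hy2) hy2) hd1) hd2) hreg, mul_nonneg (mul_nonneg (mul_nonneg (mul_nonneg hy hy2) hy2) hy2) hreg, mul_nonneg (mul_nonneg (mul_nonneg hy hy) hy) hreg, mul_nonneg (mul_nonneg (mul_nonneg hy hy) hy) hy]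


/-- Glue, region R0 (`d₁ + d₂ ≤ 1`, trivial bound on the 'both closed' branch). [this work] -/
theorem fin_R0 (y E₁ Q S T T₀ : ℝ) (hE₁ : 0 < E₁) (_hy : 0 ≤ y) (hQ0 : 0 ≤ Q) (hS0 : 0 ≤ S)
    (hN : 0 ≤ y * E₁ - Q * E₁ - S * y) (hT : T ≤ y / E₁) (hT₀ : T₀ ≤ 1) : S * T + Q * T₀ ≤ y := by
  have h1 : Q + S * (y / E₁) ≤ y := by
    rw [mul_div_assoc', ← le_sub_iff_add_le', div_le_iff₀ hE₁]
    nlinarith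
  nlinarith [mul_le_mul_of_nonneg_left hT hS0, mul_le_mul_of_nonneg_left hT₀ hQ0]

/-- Glue, region R1 (`d₁ + d₂ ≥ 1`, Cantelli on the 'both closed' branch). [this work] -/
theorem fin_R1 (y C E₀ E₁ Q S T T₀ : ℝ) (hE₀ : 0 < E₀) (hE₁ : 0 < E₁) (hy : 0 ≤ y) (hQ0 : 0 ≤ Q) (hS0 : 0 ≤ S)
    (hN : 0 ≤ E₀ * E₁ - Q * C * E₁ - S * E₀) (hT : T ≤ y / E₁) (hT₀ : T₀ ≤ y * C / E₀) : S * T + Q * T₀ ≤ y := by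
  have h1 : Q * (y * C / E₀) + S * (y / E₁) ≤ y := by
    rw [mul_div_assoc', mul_div_assoc', div_add_div _ _ hE₀.ne' hE₁.ne', div_le_iff₀ (mul_pos hE₀ hE₁)]
    nlinarith [mul_nonneg hy hN]
  nlinarith [mul_le_mul_of_nonneg_left hT hS0, mul_le_mul_of_nonneg_left hT₀ hQ0]

/-- A discounted rate `φ_x(p)` with `x² ≤ p ≤ 1` lies in `[0, 1]`. [this work] -/
theorem phi_mem (x p φ : ℝ) (hx1 : x < 1) (hp : x ^ 2 ≤ p) (hp1 : p ≤ 1)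
    (h : (if x ≤ p then p else (p - x ^ 2) / (1 - x)) = φ) : φ ≤ 1 ∧ 0 ≤ φ := by
  have hy0 : 0 < 1 - x := by linarith
  rw [← h]; split_ifs with hh
  · exact ⟨hp1, by nlinarith⟩
  · refine ⟨?_, div_nonneg (by linarith) hy0.le⟩
    rw [div_le_one hy0]; nlinarith [not_le.1 hh]

/-- Heavy or light, in the coordinates of the certificates: heavy ⟹ `φ = p`; light ⟹ `1 − p = (1−x)(1 − (1−x) + d)` with `d = 1 − φ ∈ [1−x, 1]`.
[this work] -/
theorem type_alt (x p φ : ℝ) (hx0 : 0 ≤ x) (hx1 : x < 1) (hp : x ^ 2 ≤ p)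
    (h : (if x ≤ p then p else (p - x ^ 2) / (1 - x)) = φ) :
    (x ≤ p ∧ φ = p) ∨ (p < x ∧ 1 - p = (1 - x) * (1 - (1 - x) + (1 - φ)) ∧ 0 ≤ (1 - φ) - (1 - x) ∧ 0 ≤ 1 - (1 - φ)) := by
  have hy0 : 0 < 1 - x := by linarith
  by_cases hh : x ≤ p
  · left; rw [← h, if_pos hh]; exact ⟨hh, rfl⟩
  · right
    rw [if_neg hh] at h
    have hpx := not_le.1 hh
    have hxp : x * p ≤ x * x := mul_le_mul_of_nonneg_left hpx.le hx0
    have hφx : φ ≤ x := by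
      rw [← h, div_le_iff₀ hy0]
      nlinarith [hxp]
    have hφ0 : 0 ≤ φ := by rw [← h]; exact div_nonneg (by linarith) hy0.le
    refine ⟨hpx, ?_, by linarith, by linarith⟩
    rw [← h]; field_simp; ring


end TwoFullBigsIneq

open TwoFullBigsIneq in
/-- **`TwoBigCertAt j j j` HOLDS for every `j`** — the F2 certificate when both bigs have the full size `j`. [this work] -/
theorem twoBigCertAt_full (j : ℕ) : TwoBigCertAt j j j := by
  intro x p₁ p₂ A m s2 V c hx hx1 hp₁ hp₁1 hp₂ hp₂1 hjb _ _ _ hcred hcm hclosed hmA hV0 hs20 hs2c _hs2m _hs2E hVj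
  generalize hφ₁ : (if x ≤ p₁ then p₁ else (p₁ - x ^ 2) / (1 - x)) = φ₁ at hcred
  generalize hφ₂ : (if x ≤ p₂ then p₂ else (p₂ - x ^ 2) / (1 - x)) = φ₂ at hcred
  have hx0 : 0 < x := by linarith
  have hy0 : 0 < 1 - x := by linarith
  have hj1 : 1 ≤ j := by omega
  have hjr0 : (0 : ℝ) < j := by exact_mod_cast (lt_of_lt_of_le Nat.zero_lt_one hj1)
  have hl0 : ((j - j : ℕ) : ℝ) = 0 := by simp
  obtain ⟨hφ₁1, hφ₁0⟩ := phi_mem x p₁ φ₁ hx1 hp₁ hp₁1 hφ₁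
  obtain ⟨hφ₂1, hφ₂0⟩ := phi_mem x p₂ φ₂ hx1 hp₂ hp₂1 hφ₂
  -- C̃ = d₁ + d₂ with dᵢ = 1 − φᵢ; C = j·C̃
  by_cases hC0 : (1 - φ₁) + (1 - φ₂) ≤ 0
  · -- both bigs sure: p₁ = p₂ = 1
    have hφ₁e : φ₁ = 1 := by linarith
    have hφ₂e : φ₂ = 1 := by linarith
    have hp₁e : p₁ = 1 := by
      rw [← hφ₁] at hφ₁e; split_ifs at hφ₁e with hh
      · exact hφ₁e
      · rw [div_eq_one_iff_eq hy0.ne'] at hφ₁e; nlinarith [not_le.1 hh]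
    have hp₂e : p₂ = 1 := by
      rw [← hφ₂] at hφ₂e; split_ifs at hφ₂e with hh
      · exact hφ₂e
      · rw [div_eq_one_iff_eq hy0.ne'] at hφ₂e; nlinarith [not_le.1 hh]
    refine ⟨0, 0, 0, Or.inl le_rfl, Or.inl le_rfl, Or.inl le_rfl, ?_⟩
    rw [hp₁e, hp₂e]; linarith
  have hCt : 0 < (1 - φ₁) + (1 - φ₂) := not_le.1 hC0
  obtain ⟨C, hC⟩ : ∃ C : ℝ, C = (j : ℝ) * ((1 - φ₁) + (1 - φ₂)) := ⟨_, rfl⟩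
  have hCc : C < c := by rw [hC]; linarith
  have hC0' : 0 < C := by rw [hC]; exact mul_pos hjr0 hCt
  have hmC : C < m := hCc.trans_le hcm
  have hm0 : 0 < m := hC0'.trans hmC
  have hW : V ≤ ((j : ℝ) / 2 * (1 - x)) * (2 * m - C) := by
    have h1 : s2 ≤ (1 - x) * (2 * m - C) := hs2c.trans (mul_le_mul_of_nonneg_left (by linarith) hy0.le)
    have h2 := mul_le_mul_of_nonneg_left h1 (by positivity : (0 : ℝ) ≤ (j : ℝ) / 2)
    linarith
  have hk : 0 < (j : ℝ) / 2 * (1 - x) := by positivity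
  have hp1' : 0 ≤ p₁ := le_trans (sq_nonneg x) hp₁
  have hp2' : 0 ≤ p₂ := le_trans (sq_nonneg x) hp₂
  have hS0 : 0 ≤ p₁ * (1 - p₂) + (1 - p₁) * p₂ := add_nonneg (mul_nonneg hp1' (by linarith)) (mul_nonneg (by linarith) hp2')
  -- Cantelli at level 0 for the 'one big open' branches
  have hT : V / (V + (m - ((j - j : ℕ) : ℝ)) ^ 2) ≤ (1 - x) / ((1 - x) + 2 * ((1 - φ₁) + (1 - φ₂))) := by
    rw [hl0]
    refine OneBigIneq.level_bound V ((j : ℝ) / 2 * (1 - x)) C m 0 _ hV0 hW hk le_rfl hC0'.le hmC hC0' ?_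
    have h1 : 0 < (j : ℝ) / 2 * (1 - x) * C + (C - 0) ^ 2 := add_pos_of_pos_of_nonneg (mul_pos hk hC0') (sq_nonneg _)
    have h2 : 0 < (1 - x) + 2 * ((1 - φ₁) + (1 - φ₂)) := by linarith
    rw [div_eq_div_iff h1.ne' h2.ne', hC]
    ring
  have hE₁ : 0 < (1 - x) + 2 * ((1 - φ₁) + (1 - φ₂)) := by linarith
  -- types: qᵢ and dᵢ
  by_cases hreg : 1 ≤ (1 - φ₁) + (1 - φ₂)
  · -- REGION R1: Cantelli at level j for the 'both closed' branch
    have hCj : (j : ℝ) ≤ C := by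
      have := mul_le_mul_of_nonneg_left hreg hjr0.le
      rw [hC]; linarith
    have hjm : (j : ℝ) < m := hCj.trans_lt hmC
    have hE₀ : 0 < (1 - x) * ((1 - φ₁) + (1 - φ₂)) + 2 * (((1 - φ₁) + (1 - φ₂)) - 1) ^ 2 :=
      add_pos_of_pos_of_nonneg (mul_pos hy0 hCt) (by positivity)
    have hT₀ : V / (V + (m - j) ^ 2) ≤
        (1 - x) * ((1 - φ₁) + (1 - φ₂)) / ((1 - x) * ((1 - φ₁) + (1 - φ₂)) + 2 * (((1 - φ₁) + (1 - φ₂)) - 1) ^ 2) := by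
      refine OneBigIneq.level_bound V ((j : ℝ) / 2 * (1 - x)) C m (j : ℝ) _ hV0 hW hk hjr0.le hCj hmC hC0' ?_
      have h1 : 0 < (j : ℝ) / 2 * (1 - x) * C + (C - j) ^ 2 := add_pos_of_pos_of_nonneg (mul_pos hk hC0') (sq_nonneg _)
      rw [div_eq_div_iff h1.ne' hE₀.ne', hC]
      ring
    refine ⟨1 - V / (V + (m - ((j - j : ℕ) : ℝ)) ^ 2), 1 - V / (V + (m - ((j - j : ℕ) : ℝ)) ^ 2), 1 - V / (V + (m - j) ^ 2),
      Or.inr (Or.inr ⟨by rw [hl0]; exact hm0, le_rfl⟩), Or.inr (Or.inr ⟨by rw [hl0]; exact hm0, le_rfl⟩),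
      Or.inr (Or.inr ⟨hjm, le_rfl⟩), ?_⟩
    have key : (p₁ * (1 - p₂) + (1 - p₁) * p₂) * (V / (V + (m - ((j - j : ℕ) : ℝ)) ^ 2)) + ((1 - p₁) * (1 - p₂)) * (V / (V + (m - j) ^ 2)) ≤ 1 - x := by
      refine fin_R1 (1 - x) ((1 - φ₁) + (1 - φ₂)) _ _ ((1 - p₁) * (1 - p₂)) (p₁ * (1 - p₂) + (1 - p₁) * p₂) _ _ hE₀ hE₁ hy0.le
        (mul_nonneg (by linarith) (by linarith)) hS0 ?_ hT hT₀
      rcases type_alt x p₁ φ₁ hx0.le hx1 hp₁ hφ₁ with ⟨hh1, e1⟩ | ⟨_, e1, hd1, hd1b⟩ <;>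
        rcases type_alt x p₂ φ₂ hx0.le hx1 hp₂ hφ₂ with ⟨hh2, e2⟩ | ⟨_, e2, hd2, hd2b⟩
      · -- heavy/heavy in region R1 forces x = p₁ = p₂ = 1/2
        have hxe : x = 1 / 2 := by linarith only [hx, hh1, hh2, e1, e2, hreg, hp₁1, hp₂1]
        have hp1e : p₁ = 1 / 2 := by linarith only [hx, hh1, hh2, e1, e2, hreg, hp₁1, hp₂1]
        have hp2e : p₂ = 1 / 2 := by linarith only [hx, hh1, hh2, e1, e2, hreg, hp₁1, hp₂1]
        subst e1 e2
        rw [hxe, hp1e, hp2e]; norm_num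
      · have poly := hlR1_poly (1 - x) (1 - φ₁) (1 - φ₂) hy0.le (by linarith only [hx]) (by linarith only [hφ₁1]) (by linarith only [e1, hh1]) hd2 hd2b (by linarith only [hreg])
        have hp1e : p₁ = 1 - (1 - φ₁) := by rw [e1]; ring
        have hp2e : p₂ = 1 - (1 - x) * (1 - (1 - x) + (1 - φ₂)) := by linarith only [e2]
        rw [hp1e, hp2e]
        convert poly using 1; ring
      · have poly := hlR1_poly (1 - x) (1 - φ₂) (1 - φ₁) hy0.le (by linarith only [hx]) (by linarith only [hφ₂1]) (by linarith only [e2, hh2]) hd1 hd1b (by linarith only [hreg])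
        have hp2e : p₂ = 1 - (1 - φ₂) := by rw [e2]; ring
        have hp1e : p₁ = 1 - (1 - x) * (1 - (1 - x) + (1 - φ₁)) := by linarith only [e1]
        rw [hp1e, hp2e]
        convert poly using 1; ring
      · have poly := llR1_poly (1 - x) (1 - φ₁) (1 - φ₂) hy0.le (by linarith only [hx]) hd1 hd1b hd2 hd2b (by linarith only [hreg])
        have hp1e : p₁ = 1 - (1 - x) * (1 - (1 - x) + (1 - φ₁)) := by linarith only [e1]
        have hp2e : p₂ = 1 - (1 - x) * (1 - (1 - x) + (1 - φ₂)) := by linarith only [e2]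
        rw [hp1e, hp2e]
        convert poly using 1; ring
    have e : p₁ * p₂ + (p₁ * (1 - p₂) + (1 - p₁) * p₂) + (1 - p₁) * (1 - p₂) = 1 := by ring
    linarith only [key, e]
  · -- REGION R0: trivial bound on the 'both closed' branch
    have hreg' : (1 - φ₁) + (1 - φ₂) ≤ 1 := (not_le.1 hreg).le
    refine ⟨1 - V / (V + (m - ((j - j : ℕ) : ℝ)) ^ 2), 1 - V / (V + (m - ((j - j : ℕ) : ℝ)) ^ 2), 0,
      Or.inr (Or.inr ⟨by rw [hl0]; exact hm0, le_rfl⟩), Or.inr (Or.inr ⟨by rw [hl0]; exact hm0, le_rfl⟩), Or.inl le_rfl, ?_⟩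
    have key : (p₁ * (1 - p₂) + (1 - p₁) * p₂) * (V / (V + (m - ((j - j : ℕ) : ℝ)) ^ 2)) + ((1 - p₁) * (1 - p₂)) * 1 ≤ 1 - x := by
      refine fin_R0 (1 - x) _ ((1 - p₁) * (1 - p₂)) (p₁ * (1 - p₂) + (1 - p₁) * p₂) _ _ hE₁ hy0.le
        (mul_nonneg (by linarith) (by linarith)) hS0 ?_ hT le_rfl
      rcases type_alt x p₁ φ₁ hx0.le hx1 hp₁ hφ₁ with ⟨hh1, e1⟩ | ⟨_, e1, hd1, hd1b⟩ <;>
        rcases type_alt x p₂ φ₂ hx0.le hx1 hp₂ hφ₂ with ⟨hh2, e2⟩ | ⟨_, e2, hd2, hd2b⟩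
      · have poly := hhR0_poly (1 - x) (1 - φ₁) (1 - φ₂) hy0.le (by linarith only [hx]) (by linarith only [hφ₁1]) (by linarith only [e1, hh1])
          (by linarith only [hφ₂1]) (by linarith only [e2, hh2]) (by linarith only [hreg'])
        have hp1e : p₁ = 1 - (1 - φ₁) := by rw [e1]; ring
        have hp2e : p₂ = 1 - (1 - φ₂) := by rw [e2]; ring
        rw [hp1e, hp2e]
        convert poly using 1; ring
      · have poly := hlR0_poly (1 - x) (1 - φ₁) (1 - φ₂) hy0.le (by linarith only [hx]) (by linarith only [hφ₁1]) (by linarith only [e1, hh1]) hd2 hd2b (by linarith only [hreg'])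
        have hp1e : p₁ = 1 - (1 - φ₁) := by rw [e1]; ring
        have hp2e : p₂ = 1 - (1 - x) * (1 - (1 - x) + (1 - φ₂)) := by linarith only [e2]
        rw [hp1e, hp2e]
        convert poly using 1; ring
      · have poly := hlR0_poly (1 - x) (1 - φ₂) (1 - φ₁) hy0.le (by linarith only [hx]) (by linarith only [hφ₂1]) (by linarith only [e2, hh2]) hd1 hd1b (by linarith only [hreg'])
        have hp2e : p₂ = 1 - (1 - φ₂) := by rw [e2]; ring
        have hp1e : p₁ = 1 - (1 - x) * (1 - (1 - x) + (1 - φ₁)) := by linarith only [e1]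
        rw [hp1e, hp2e]
        convert poly using 1; ring
      · have poly := llR0_poly (1 - x) (1 - φ₁) (1 - φ₂) hy0.le (by linarith only [hx]) hd1 hd1b hd2 hd2b (by linarith only [hreg'])
        have hp1e : p₁ = 1 - (1 - x) * (1 - (1 - x) + (1 - φ₁)) := by linarith only [e1]
        have hp2e : p₂ = 1 - (1 - x) * (1 - (1 - x) + (1 - φ₂)) := by linarith only [e2]
        rw [hp1e, hp2e]
        convert poly using 1; ring
    have e : p₁ * p₂ + (p₁ * (1 - p₂) + (1 - p₁) * p₂) + (1 - p₁) * (1 - p₂) = 1 := by ring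
    linarith only [key, e]

end IndepBlob

namespace RootDec

variable {κ : Type} [Fintype κ] [DecidableEq κ]

/-- **DIB\* for every system with TWO blobs of size exactly `j` and all other blobs of size `≤ j/2`** (floor `1/2 ≤ x < 1`, gates in `[x², 1]`,
credit `> 2j`): `twoBig_row_of_certAt` + `twoBigCertAt_full`. [this work] -/
theorem tail_ge_of_twoFullBigs (a : κ → ℕ) (g : κ → ℝ) (j : ℕ) (x : ℝ) (hx : 1 / 2 ≤ x) (hx1 : x < 1)
    (hg : ∀ i, 0 ≤ g i ∧ g i ≤ 1) (hjunk : ∀ i, x ^ 2 ≤ g i) (k₁ k₂ : κ) (hne : k₁ ≠ k₂)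
    (hk₁ : a k₁ = j) (hk₂ : a k₂ = j) (hj : 1 ≤ j) (hsmall : ∀ i, i ≠ k₁ → i ≠ k₂ → 2 * a i ≤ j)
    (hcredit : (2 * j : ℝ) < ∑ i, (a i : ℝ) * (if x ≤ g i then g i else (g i - x ^ 2) / (1 - x))) :
    x ≤ ∑ W : Finset κ, (∏ i, if i ∈ W then g i else 1 - g i) * (if j + 1 ≤ ∑ i ∈ W, a i then (1 : ℝ) else 0) := by
  have hC : IndepBlob.TwoBigCertAt (a k₁) (a k₂) j := by rw [hk₁, hk₂]; exact IndepBlob.twoBigCertAt_full j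
  exact twoBig_row_of_certAt a g j x hx hx1 hg hjunk k₁ k₂ hne (by omega) (by omega) (by omega) (by omega) hsmall hcredit hC

end RootDec

end Quant
end Summit.CriticalPhenomena.PercolationContinuityZ3.Theorems
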